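import Summits.ValiantsHypothesis.ValiantsHypothesis.Theorems.KPlusLogSqLawTridiagonalRealStaticFourByFourMult
import Summits.ValiantsHypothesis.ValiantsHypothesis.Theorems.KPlusLogSqLawStaticTridiagonalFourByFourSharpAll
import Summits.ValiantsHypothesis.ValiantsHypothesis.Theorems.KPlusLogSqLawTridiagonalRealStaticPotentialStepTwoReduction

/-!
# Route «KPlusLogSqLaw», crux `WeakLifting` (stmt-ValiantsHypothesis-19561) — REAL side of the tridiagonal sector:
# `B 4 ≤ 3` WITH MULTIPLICITY, and the step `(P)_2` of conjecture (P) holds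

HONEST FRAMING.  Helper (`--supports stmt-ValiantsHypothesis-19561 --as helper`), seat val-sym-lift-p3 (g10), cell `pub-symmetroid`,
2026-08-27/28.  From the cell's sharp row `B 4 ≤ 3` (lift-p2 g9, `card_posRoots_four_le_three_all`: at most three DISTINCT positive zeros)
and the companion file's (M) (double zeros of `D₄` are nondegenerate maxima, no multiplicity `≥ 3`), a PERTURBATION of the middle link
(`b₁² ↦ b₁² − δ` adds `δ·a₃a₀X^{d₃+d₀+2f₁} > 0` to `D₄`) splits every double zero into two simple ones and keeps every simple zero, so
`Σ multiplicities ≤ #distinct zeros of the perturbed design ≤ 3`: **`countP_roots_pos_pathDet_four_le_three`** — every static definite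
symmetric tridiagonal `4 × 4` monomial design with nonzero links has at most THREE positive determinant zeros COUNTED WITH MULTIPLICITY.
With `potentialStep_two_of_fourMult` (counting): **`potentialStep_two : PotentialStep 2`** — the step «(P) at `m = 4`» of conjecture (P)
(desk R2278's «fine rung») holds, and the conditional row is unconditional for `m ≤ 4` (`card_posRoots_le_of_size_le_four`, weaker than
`B 4 ≤ 3` itself — a sanity instance of the reduction).  (P) stays OPEN from `k = 3` on; α does not move.  Nothing here bears on `WeakLifting` /
`TropicalB` (stmt-19771) in their windows, on Conjecture B, on the Door-A registers, on `MatrixDescartes` (stmt-ValiantsHypothesis-18050) or on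
VP ≠ VNP.
[folklore: perturbation of simple/double real zeros (IVT); this cell's memo CONDITIONAL-UPPER-ROW-liftp3g10.md §5–§6]
-/

-- `Summit.ValiantsHypothesis.ValiantsHypothesis.…` repeats a component by the D-0017 layout (single-conjunct summit); the name is mandated.
set_option linter.dupNamespace false
set_option autoImplicit false

namespace Summit.ValiantsHypothesis.ValiantsHypothesis.Theorems.KPlusLogSqLaw

namespace StaticTridiagonalRealPotential

open Polynomial
open Summit.ValiantsHypothesis.ValiantsHypothesis.Theorems.KPlusLogSqLaw.DefiniteInterpolation (card_posRoots_four_le_three_all)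

/-! ### Local structure of a simple or nondegenerate-maximal double zero under a positive perturbation -/

/-- **Local splitting lemma.**  Let `s > 0` be a zero of `P ≠ 0` which is simple, or double with `P″(s) < 0`, and let `Q` be positive on
`(0, ∞)`.  For every radius `ρ > 0` there is `δ₀ > 0` such that for all `0 < δ < δ₀` the polynomial `P + δ·Q` has (at least) `mult_s(P)`
distinct positive zeros within distance `ρ` of `s`. [folklore: IVT] -/
theorem exists_roots_near_of_perturb (P Q : ℝ[X]) (hP : P ≠ 0) (hQ : ∀ y : ℝ, 0 < y → 0 < Q.eval y) {s : ℝ} (hs : 0 < s)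
    (hroot : P.IsRoot s)
    (hμ : P.rootMultiplicity s = 1 ∨ (P.rootMultiplicity s = 2 ∧ (derivative (derivative P)).eval s < 0)) {ρ : ℝ} (hρ : 0 < ρ) :
    ∃ δ₀ : ℝ, 0 < δ₀ ∧ ∀ δ : ℝ, 0 < δ → δ < δ₀ →
      ∃ T : Finset ℝ, T.card = P.rootMultiplicity s ∧ ∀ y ∈ T, |y - s| < ρ ∧ 0 < y ∧ (P + C δ * Q).IsRoot y := by
  classical
  -- factor `P = (X − s)^μ · R` with `R(s) ≠ 0`
  set μ := P.rootMultiplicity s with hμdef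
  set R := P /ₘ (X - C s) ^ μ with hR
  have hfac : (X - C s) ^ μ * R = P := pow_mul_divByMonic_rootMultiplicity_eq P s
  have hRs : R.eval s ≠ 0 := eval_divByMonic_pow_rootMultiplicity_ne_zero s hP
  -- continuity of `R`: a radius `η ≤ ρ, s/2` on which `R` keeps the sign of `R(s)` (indeed `|R y − R s| < |R s| / 2`)
  obtain ⟨η₀, hη₀, hη₀R⟩ : ∃ η₀ > 0, ∀ y, |y - s| < η₀ → |R.eval y - R.eval s| < |R.eval s| / 2 := by
    have hc := (R.continuousAt (a := s))
    rw [Metric.continuousAt_iff] at hc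
    obtain ⟨η₀, hη₀, h⟩ := hc (|R.eval s| / 2) (by positivity)
    exact ⟨η₀, hη₀, fun y hy => by simpa [Real.dist_eq] using h (by simpa [Real.dist_eq] using hy)⟩
  set η := min (η₀ / 2) (min ρ (s / 2)) with hη
  have hηpos : 0 < η := by positivity
  have hηρ : η ≤ ρ := (min_le_right _ _).trans (min_le_left _ _)
  have hηs : η ≤ s / 2 := (min_le_right _ _).trans (min_le_right _ _)
  have hη₀' : η < η₀ := lt_of_le_of_lt (min_le_left _ _) (by linarith)
  -- sign of `R` on `[s − η, s + η]`
  have hRsign : ∀ y, |y - s| ≤ η → 0 < R.eval y * R.eval s := by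
    intro y hy
    have h := hη₀R y (lt_of_le_of_lt hy hη₀')
    rcases lt_or_gt_of_ne hRs with hneg | hpos
    · rw [abs_of_neg hneg] at h
      have : R.eval y < 0 := by have := (abs_lt.1 h).2; linarith
      exact mul_pos_of_neg_of_neg this hneg
    · rw [abs_of_pos hpos] at h
      have : 0 < R.eval y := by have := (abs_lt.1 h).1; linarith
      exact mul_pos this hpos
  -- values of `P` at `s ± η`
  have hPval : ∀ y, P.eval y = (y - s) ^ μ * R.eval y := by
    intro y; rw [← hfac, eval_mul, eval_pow, eval_sub, eval_X, eval_C]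
  have hl : |s - η - s| ≤ η := by rw [show s - η - s = -η by ring, abs_neg, abs_of_pos hηpos]
  have hr : |s + η - s| ≤ η := by rw [show s + η - s = η by ring, abs_of_pos hηpos]
  -- the perturbation threshold
  have hQl : 0 < Q.eval (s - η) := hQ _ (by linarith)
  have hQr : 0 < Q.eval (s + η) := hQ _ (by linarith)
  have hPl0 : P.eval (s - η) ≠ 0 := by
    rw [hPval]; exact mul_ne_zero (pow_ne_zero _ (by linarith)) fun h => by have := hRsign _ hl; rw [h, zero_mul] at this; exact lt_irrefl _ this
  have hPr0 : P.eval (s + η) ≠ 0 := by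
    rw [hPval]; exact mul_ne_zero (pow_ne_zero _ (by linarith)) fun h => by have := hRsign _ hr; rw [h, zero_mul] at this; exact lt_irrefl _ this
  refine ⟨min (|P.eval (s - η)| / Q.eval (s - η)) (|P.eval (s + η)| / Q.eval (s + η)),
    lt_min (div_pos (abs_pos.2 hPl0) hQl) (div_pos (abs_pos.2 hPr0) hQr), fun δ hδ hδlt => ?_⟩
  -- at `s ± η` the perturbed polynomial has the sign of `P`
  have hkeep : ∀ y, 0 < Q.eval y → δ < |P.eval y| / Q.eval y → (P.eval y < 0 → (P + C δ * Q).eval y < 0) ∧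
      (0 < P.eval y → 0 < (P + C δ * Q).eval y) := by
    intro y hQy hδy
    have hδQ : δ * Q.eval y < |P.eval y| := by rwa [lt_div_iff₀ hQy] at hδy
    refine ⟨fun hneg => ?_, fun hpos => ?_⟩
    · rw [eval_add, eval_mul, eval_C]; rw [abs_of_neg hneg] at hδQ; linarith
    · rw [eval_add, eval_mul, eval_C]; have : 0 < δ * Q.eval y := mul_pos hδ hQy; linarith
  have hkl := hkeep (s - η) hQl (lt_of_lt_of_le hδlt (min_le_left _ _))
  have hkr := hkeep (s + η) hQr (lt_of_lt_of_le hδlt (min_le_right _ _))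
  have hcont : ∀ u v : ℝ, ContinuousOn (fun y => (P + C δ * Q).eval y) (Set.Icc u v) := fun u v => (Polynomial.continuous _).continuousOn
  rcases hμ with h1 | ⟨h2, hsec⟩
  · -- simple zero: `P` changes sign across `s`
    have hμ1 : μ = 1 := h1
    have hopp : P.eval (s - η) * P.eval (s + η) < 0 := by
      rw [hPval, hPval, hμ1, pow_one, pow_one]
      have h1 := hRsign _ hl
      have h2 := hRsign _ hr
      have hRs2 : 0 < R.eval s ^ 2 := by positivity
      have h12 : 0 < R.eval (s - η) * R.eval (s + η) := by
        have h := mul_pos h1 h2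
        have e : R.eval (s - η) * R.eval s * (R.eval (s + η) * R.eval s) = R.eval (s - η) * R.eval (s + η) * R.eval s ^ 2 := by ring
        rw [e] at h
        exact (mul_pos_iff_of_pos_right hRs2).1 h
      have e : (s - η - s) * R.eval (s - η) * ((s + η - s) * R.eval (s + η)) = -(η ^ 2 * (R.eval (s - η) * R.eval (s + η))) := by ring
      rw [e, neg_lt_zero]
      exact mul_pos (pow_pos hηpos 2) h12
    -- a zero of the perturbed polynomial in `(s − η, s + η)`
    obtain ⟨y, hy, hy0⟩ : ∃ y ∈ Set.Ioo (s - η) (s + η), (P + C δ * Q).eval y = 0 := by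
      rcases lt_or_gt_of_ne hPl0 with hneg | hpos
      · have hpos' : 0 < P.eval (s + η) := by nlinarith
        exact intermediate_value_Ioo (by linarith) (hcont _ _) ⟨hkl.1 hneg, hkr.2 hpos'⟩
      · have hneg' : P.eval (s + η) < 0 := by nlinarith
        exact intermediate_value_Ioo' (by linarith) (hcont _ _) ⟨hkr.1 hneg', hkl.2 hpos⟩
    refine ⟨{y}, by rw [Finset.card_singleton, hμ1], fun z hz => ?_⟩
    rw [Finset.mem_singleton] at hz
    subst hz
    exact ⟨by rw [abs_lt]; constructor <;> linarith [hy.1, hy.2], by linarith [hy.1], hy0⟩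
  · -- double zero, nondegenerate maximum: `R(s) < 0`, so `P < 0` at `s ± η`, while the perturbation is `> 0` at `s`
    have hμ2 : μ = 2 := h2
    have hRneg : R.eval s < 0 := by
      -- `P″(s) = 2 R(s)`
      have key1 : ∀ F : ℝ[X], (derivative ((X - C s) * F)).eval s = F.eval s := by
        intro F
        rw [derivative_mul, derivative_sub, derivative_X, derivative_C, sub_zero, one_mul, eval_add, eval_mul, eval_sub, eval_X,
          eval_C, sub_self, zero_mul, add_zero]
      have key2 : ∀ F : ℝ[X], (derivative (derivative ((X - C s) * F))).eval s = 2 * (derivative F).eval s := by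
        intro F
        rw [derivative_mul, derivative_sub, derivative_X, derivative_C, sub_zero, one_mul, derivative_add, eval_add, key1]
        ring
      have hd : (derivative (derivative P)).eval s = 2 * R.eval s := by
        rw [← hfac, hμ2, pow_two, mul_assoc, key2, key1]
      rw [hd] at hsec; linarith
    have hPl : P.eval (s - η) < 0 := by
      rw [hPval, hμ2]; have := hRsign _ hl; nlinarith [sq_nonneg (s - η - s), pow_pos hηpos 2]
    have hPr : P.eval (s + η) < 0 := by
      rw [hPval, hμ2]; have := hRsign _ hr; nlinarith [sq_nonneg (s + η - s), pow_pos hηpos 2]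
    have hmid : 0 < (P + C δ * Q).eval s := by
      rw [eval_add, eval_mul, eval_C, hroot.eq_zero, zero_add]; exact mul_pos hδ (hQ s hs)
    obtain ⟨y₁, hy₁, hy₁0⟩ : ∃ y ∈ Set.Ioo (s - η) s, (P + C δ * Q).eval y = 0 :=
      intermediate_value_Ioo (by linarith) (hcont _ _) ⟨hkl.1 hPl, hmid⟩
    obtain ⟨y₂, hy₂, hy₂0⟩ : ∃ y ∈ Set.Ioo s (s + η), (P + C δ * Q).eval y = 0 :=
      intermediate_value_Ioo' (by linarith) (hcont _ _) ⟨hkr.1 hPr, hmid⟩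
    have hne : y₁ ≠ y₂ := by have := hy₁.2; have := hy₂.1; exact ne_of_lt (by linarith)
    refine ⟨{y₁, y₂}, by rw [Finset.card_pair hne, hμ2], fun z hz => ?_⟩
    rw [Finset.mem_insert, Finset.mem_singleton] at hz
    rcases hz with rfl | rfl
    · exact ⟨by rw [abs_lt]; constructor <;> linarith [hy₁.1, hy₁.2], by linarith [hy₁.1], hy₁0⟩
    · exact ⟨by rw [abs_lt]; constructor <;> linarith [hy₂.1, hy₂.2], by linarith [hy₂.1], hy₂0⟩

/-- Uniform threshold over a finite set for a property that is downward closed in `δ`. [bookkeeping] -/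
theorem exists_uniform_threshold {S : Finset ℝ} {p : ℝ → ℝ → Prop}
    (h : ∀ s ∈ S, ∃ δ₀ : ℝ, 0 < δ₀ ∧ ∀ δ : ℝ, 0 < δ → δ < δ₀ → p s δ) :
    ∃ δ₀ : ℝ, 0 < δ₀ ∧ ∀ δ : ℝ, 0 < δ → δ < δ₀ → ∀ s ∈ S, p s δ := by
  classical
  induction S using Finset.induction_on with
  | empty => exact ⟨1, one_pos, fun _ _ _ s hs => absurd hs (Finset.notMem_empty _)⟩
  | insert x S hx ih =>
    obtain ⟨δ₁, hδ₁, h₁⟩ := h x (Finset.mem_insert_self _ _)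
    obtain ⟨δ₂, hδ₂, h₂⟩ := ih fun s hs => h s (Finset.mem_insert_of_mem hs)
    refine ⟨min δ₁ δ₂, lt_min hδ₁ hδ₂, fun δ hδ hδlt s hs => ?_⟩
    rw [Finset.mem_insert] at hs
    rcases hs with rfl | hs
    · exact h₁ δ hδ (lt_of_lt_of_le hδlt (min_le_left _ _))
    · exact h₂ δ hδ (lt_of_lt_of_le hδlt (min_le_right _ _)) s hs

/-- A positive real below finitely many positive reals. [bookkeeping] -/
theorem exists_pos_lt_forall (A : Finset ℝ) (hA : ∀ x ∈ A, 0 < x) : ∃ ρ : ℝ, 0 < ρ ∧ ∀ x ∈ A, ρ < x := by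
  classical
  induction A using Finset.induction_on with
  | empty => exact ⟨1, one_pos, fun _ hx => absurd hx (Finset.notMem_empty _)⟩
  | insert y A hy ih =>
    obtain ⟨ρ, hρ, h⟩ := ih fun x hx => hA x (Finset.mem_insert_of_mem hx)
    have hy0 : 0 < y := hA y (Finset.mem_insert_self _ _)
    refine ⟨min (y / 2) ρ, lt_min (by linarith) hρ, fun x hx => ?_⟩
    rw [Finset.mem_insert] at hx
    rcases hx with rfl | hx
    · exact lt_of_le_of_lt (min_le_left _ _) (by linarith)
    · exact lt_of_le_of_lt (min_le_right _ _) (h x hx)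

/-! ### The cell's `B 4 ≤ 3` in the continuant currency, and the perturbed design -/

variable (a : ℕ → ℝ) (d : ℕ → ℕ) (b : ℕ → ℝ) (f : ℕ → ℕ)

/-- **`B 4 ≤ 3` (lift-p2 g9, `card_posRoots_four_le_three_all`) in the continuant currency**: `D₄` of a static definite symmetric
tridiagonal `4 × 4` design has at most three DISTINCT positive zeros. [the cell's kernel row, rephrased] -/
theorem card_posRoots_pathDet_four_le_three (ha : ∀ t, 0 < a t) :
    ((pathDet a d b f 4).roots.toFinset.filter (fun x => 0 < x)).card ≤ 3 := by
  classical
  -- the design as a matrix in the R2114 currency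
  set c : Fin 4 → Fin 4 → ℝ := fun i j =>
    if (j : ℕ) = i then a i else if (j : ℕ) = i + 1 then b i else if (i : ℕ) = j + 1 then b j else 0 with hc
  set e : Fin 4 → Fin 4 → ℕ := fun i j =>
    if (j : ℕ) = i then d i else if (j : ℕ) = i + 1 then f i else if (i : ℕ) = j + 1 then f j else 0 with he
  have hcs : ∀ i j, c i j = c j i := by
    intro i j
    by_cases hij : i = j
    · subst hij; rfl
    · have h1 : (j : ℕ) ≠ i := fun h => hij (Fin.ext h.symm)
      have h2 : (i : ℕ) ≠ j := fun h => hij (Fin.ext h)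
      simp only [hc, if_neg h1, if_neg h2]
      split_ifs <;> first | rfl | (exfalso; omega)
  have hes : ∀ i j, e i j = e j i := by
    intro i j
    by_cases hij : i = j
    · subst hij; rfl
    · have h1 : (j : ℕ) ≠ i := fun h => hij (Fin.ext h.symm)
      have h2 : (i : ℕ) ≠ j := fun h => hij (Fin.ext h)
      simp only [he, if_neg h1, if_neg h2]
      split_ifs <;> first | rfl | (exfalso; omega)
  have hband : ∀ i j : Fin 4, (i : ℕ) + 1 < j ∨ (j : ℕ) + 1 < i → c i j = 0 := by
    intro i j hij
    simp only [hc]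
    split_ifs <;> first | rfl | (exfalso; omega)
  have hpos : ∀ i, 0 < c i i := by intro i; simp only [hc, if_pos rfl]; exact ha i
  have hmain := card_posRoots_four_le_three_all c e hcs hband hpos
  have hdet : (Matrix.of fun i j : Fin 4 => C (c i j) * (X : ℝ[X]) ^ e i j).det = pathDet a d b f 4 := by
    rw [det_of_eq_pathDet c e hcs hes hband]
    refine pathDet_congr (fun t ht => ?_) (fun t ht => ?_) (fun t ht => ?_) (fun t ht => ?_)
    · rw [dif_pos ht]; simp only [hc, if_pos rfl]
    · rw [dif_pos ht]; simp only [he, if_pos rfl]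
    · rw [dif_pos ht]; simp only [hc]; rw [if_neg (by simp), if_pos (by simp)]
    · rw [dif_pos ht]; simp only [he]; rw [if_neg (by simp), if_pos (by simp)]
  rw [hdet] at hmain
  exact hmain

/-- **The perturbed design**: lowering `b₁²` by `δ` adds `δ·a₃a₀·X^{d₃+d₀+2f₁}` to `D₄`. [this file] -/
theorem pathDet_four_update (δ : ℝ) (hδ : δ ≤ b 1 ^ 2) :
    pathDet a d (Function.update b 1 (Real.sqrt (b 1 ^ 2 - δ))) f 4 =
      pathDet a d b f 4 + C δ * (C (a 3 * a 0) * X ^ (d 3 + d 0 + 2 * f 1)) := by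
  rw [pathDet_four, pathDet_four]
  have h0 : Function.update b 1 (Real.sqrt (b 1 ^ 2 - δ)) 0 = b 0 := Function.update_of_ne (by norm_num) _ _
  have h2 : Function.update b 1 (Real.sqrt (b 1 ^ 2 - δ)) 2 = b 2 := Function.update_of_ne (by norm_num) _ _
  have h1 : Function.update b 1 (Real.sqrt (b 1 ^ 2 - δ)) 1 ^ 2 = b 1 ^ 2 - δ := by
    rw [Function.update_self, Real.sq_sqrt (sub_nonneg.2 hδ)]
  rw [h0, h2, h1]
  simp only [map_sub, map_mul]
  ring

/-! ### `B 4 ≤ 3` with multiplicity -/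

/-- **`B 4 ≤ 3` WITH MULTIPLICITY**: a static definite symmetric tridiagonal `4 × 4` monomial design with nonzero links has at most three
positive determinant zeros COUNTED WITH MULTIPLICITY.  (Perturb `b₁² ↦ b₁² − δ`: every simple zero persists, every double zero — a
nondegenerate maximum by (M) — splits into two, and the perturbed design still obeys the cell's `B 4 ≤ 3`.) [this file] -/
theorem countP_roots_pos_pathDet_four_le_three (ha : ∀ t, 0 < a t) (hb : ∀ t, b t ≠ 0) :
    (pathDet a d b f 4).roots.countP (fun x => 0 < x) ≤ 3 := by
  classical
  set P := pathDet a d b f 4 with hPdef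
  by_cases hP : P = 0
  · rw [hP, roots_zero]; simp
  by_contra hgt
  push Not at hgt
  set S := P.roots.toFinset.filter (fun x => 0 < x) with hS
  have hsum : ∑ s ∈ S, P.rootMultiplicity s = P.roots.countP (fun x => 0 < x) :=
    sum_rootMultiplicity_eq S (fun x hx => (Finset.mem_filter.1 hx).2) (Finset.Subset.refl _)
  have hSroot : ∀ s ∈ S, 0 < s ∧ P.IsRoot s := fun s hs => by
    rw [hS, Finset.mem_filter, Multiset.mem_toFinset] at hs; exact ⟨hs.2, (mem_roots hP).1 hs.1⟩
  have hμ : ∀ s ∈ S, P.rootMultiplicity s = 1 ∨ (P.rootMultiplicity s = 2 ∧ (derivative (derivative P)).eval s < 0) := by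
    intro s hs
    obtain ⟨hs0, hr⟩ := hSroot s hs
    have hle : P.rootMultiplicity s ≤ 2 := rootMultiplicity_pathDet_four_le_two a d b f ha hb hP hs0
    have hge : 0 < P.rootMultiplicity s := (rootMultiplicity_pos hP).2 hr
    by_cases h2 : P.rootMultiplicity s = 2
    · right
      refine ⟨h2, derivative_two_neg_of_double_root a d b f ha hb hP hs0 hr ?_⟩
      have h := isRoot_iterate_derivative_of_lt_rootMultiplicity (p := P) (t := s) (n := 1) (by omega)
      simpa using h
    · left; omega
  -- the perturbation polynomial
  set Q : ℝ[X] := C (a 3 * a 0) * X ^ (d 3 + d 0 + 2 * f 1) with hQ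
  have hQpos : ∀ y : ℝ, 0 < y → 0 < Q.eval y := by
    intro y hy; rw [hQ, eval_mul, eval_C, eval_pow, eval_X]; exact mul_pos (mul_pos (ha 3) (ha 0)) (pow_pos hy _)
  -- a separation radius
  have hSne : S.Nonempty := by
    by_contra h
    rw [Finset.not_nonempty_iff_eq_empty] at h
    rw [← hsum, h, Finset.sum_empty] at hgt
    exact absurd hgt (by norm_num)
  obtain ⟨ρ, hρ, hρlt⟩ := exists_pos_lt_forall (S ∪ ((S ×ˢ S).filter (fun q => q.1 ≠ q.2)).image (fun q => |q.1 - q.2| / 2))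
    (by
      intro x hx
      rw [Finset.mem_union] at hx
      rcases hx with hx | hx
      · exact (hSroot x hx).1
      · rw [Finset.mem_image] at hx
        obtain ⟨q, hq, rfl⟩ := hx
        rw [Finset.mem_filter] at hq
        have : 0 < |q.1 - q.2| := abs_pos.2 (sub_ne_zero.2 hq.2)
        positivity)
  have hρS : ∀ s ∈ S, ρ < s := fun s hs => hρlt s (Finset.mem_union_left _ hs)
  have hρsep : ∀ s ∈ S, ∀ s' ∈ S, s ≠ s' → 2 * ρ < |s - s'| := by
    intro s hs s' hs' hne
    have h := hρlt (|s - s'| / 2) (Finset.mem_union_right _ (Finset.mem_image.2 ⟨(s, s'), Finset.mem_filter.2 ⟨Finset.mem_product.2 ⟨hs, hs'⟩, hne⟩, rfl⟩))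
    linarith
  -- local splitting at every root, uniformly in `δ`
  have hloc : ∀ s ∈ S, ∃ δ₀ : ℝ, 0 < δ₀ ∧ ∀ δ : ℝ, 0 < δ → δ < δ₀ →
      ∃ T : Finset ℝ, T.card = P.rootMultiplicity s ∧ ∀ y ∈ T, |y - s| < ρ ∧ 0 < y ∧ (P + C δ * Q).IsRoot y :=
    fun s hs => exists_roots_near_of_perturb P Q hP hQpos (hSroot s hs).1 (hSroot s hs).2 (hμ s hs) hρ
  obtain ⟨δ₀, hδ₀, hunif⟩ := exists_uniform_threshold hloc
  -- the perturbation size: below the threshold and below `b₁²`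
  have hb1 : 0 < b 1 ^ 2 := lt_of_le_of_ne (sq_nonneg _) (Ne.symm (pow_ne_zero 2 (hb 1)))
  set δ := min (δ₀ / 2) (b 1 ^ 2 / 2) with hδdef
  have hδpos : 0 < δ := lt_min (by linarith) (by linarith)
  have hδlt : δ < δ₀ := lt_of_le_of_lt (min_le_left _ _) (by linarith)
  have hδb : δ ≤ b 1 ^ 2 := (min_le_right _ _).trans (by linarith)
  choose! T hT using hunif δ hδpos hδlt
  -- the perturbed determinant and its root count
  set Pδ := P + C δ * Q with hPδ
  have hPδdesign : pathDet a d (Function.update b 1 (Real.sqrt (b 1 ^ 2 - δ))) f 4 = Pδ := by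
    rw [hPδ, hPdef, hQ, pathDet_four_update a d b f δ hδb]
  have hPδne : Pδ ≠ 0 := by
    obtain ⟨s, hs⟩ := hSne
    intro h0
    have h1 : Pδ.eval s = δ * Q.eval s := by rw [hPδ, eval_add, eval_mul, eval_C, (hSroot s hs).2.eq_zero, zero_add]
    rw [h0, eval_zero] at h1
    exact absurd h1.symm (mul_pos hδpos (hQpos s (hSroot s hs).1)).ne'
  have hle3 : ((Pδ.roots.toFinset.filter (fun x => 0 < x))).card ≤ 3 := by
    rw [← hPδdesign]; exact card_posRoots_pathDet_four_le_three a d _ f ha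
  -- the union of the local root sets: `Σ mult` distinct positive roots of the perturbed determinant
  have hdisj : (S : Set ℝ).PairwiseDisjoint T := by
    intro s hs s' hs' hne
    rw [Function.onFun, Finset.disjoint_left]
    intro y hy hy'
    have h1 := ((hT s hs).2 y hy).1
    have h2 := ((hT s' hs').2 y hy').1
    have h3 := hρsep s hs s' hs' hne
    have : |s - s'| ≤ |y - s| + |y - s'| := by
      rw [show s - s' = (y - s') - (y - s) by ring]; exact (abs_sub _ _).trans (by rw [add_comm])
    linarith
  have hcardU : (S.biUnion T).card = ∑ s ∈ S, P.rootMultiplicity s := by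
    rw [Finset.card_biUnion hdisj]
    exact Finset.sum_congr rfl fun s hs => (hT s hs).1
  have hsub : S.biUnion T ⊆ Pδ.roots.toFinset.filter (fun x => 0 < x) := by
    intro y hy
    rw [Finset.mem_biUnion] at hy
    obtain ⟨s, hs, hys⟩ := hy
    obtain ⟨-, hy0, hyroot⟩ := (hT s hs).2 y hys
    exact Finset.mem_filter.2 ⟨Multiset.mem_toFinset.2 ((mem_roots hPδne).2 hyroot), hy0⟩
  have := Finset.card_le_card hsub
  rw [hcardU, hsum] at this
  omega

/-- **THE STEP `(P)_2` OF CONJECTURE (P) HOLDS** («(P) at `m = 4`», desk R2278's rung): for every static definite symmetric tridiagonal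
monomial design with nonzero links, `Θ(rootWord D₃ D₄) ≤ Θ(rootWord D₂ D₃) + 2`. [this file + `potentialStep_two_of_fourMult`] -/
theorem potentialStep_two : PotentialStep 2 :=
  potentialStep_two_of_fourMult fun a d b f ha hb => countP_roots_pos_pathDet_four_le_three a d b f ha hb

/-- Hence the conditional row `card posRoots ≤ 2m − 2` is UNCONDITIONAL for all sizes `m ≤ 4` (weaker than the cell's sharp
`B 2 = 1`, `B 3 = 2`, `B 4 = 3`; a sanity instance of the reduction to (P)). [corollary] -/
theorem card_posRoots_le_of_size_le_four (m : ℕ) (hm : m ≤ 4)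
    (c : Fin m → Fin m → ℝ) (e : Fin m → Fin m → ℕ) (hc : ∀ i j, c i j = c j i) (he : ∀ i j, e i j = e j i)
    (hband : ∀ i j : Fin m, (i : ℕ) + 1 < j ∨ (j : ℕ) + 1 < i → c i j = 0) (hpos : ∀ i, 0 < c i i) :
    ((Matrix.det (Matrix.of fun i j => C (c i j) * (X : ℝ[X]) ^ e i j)).roots.toFinset.filter
      (fun t : ℝ => 0 < t)).card ≤ 2 * m - 2 := by
  refine card_posRoots_le_of_potentialSteps m (fun j hj => ?_) c e hc he hband hpos
  have hj2 : j ≤ 2 := by omega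
  interval_cases j
  · exact potentialStep_zero
  · exact potentialStep_one
  · exact potentialStep_two

end StaticTridiagonalRealPotential

end Summit.ValiantsHypothesis.ValiantsHypothesis.Theorems.KPlusLogSqLaw
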